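import Summits.CriticalPhenomena.PercolationContinuityZ3.Theorems.PercNearOneGluingNoHeavyLowerTailFKExactEval
import HarnessLib

/-!
# Three-way separation does NOT make a cluster positively associated: an exact seven-vertex witness
# (PAPER-2 track (ii): constants of the CSH family; seat `prim-consts-2`, gen 11)

builds on p205010 (kernel theorem, internal audit signed; external expert review pending).  Support file
(`--supports stmt-CriticalPhenomena-4575`); memo `run/shared/lean/prim/consts/FROM-prim-consts-2-g11-THREESEP.md`; rows A6/A11 of
`run/shared/lean/prim/consts/CONSTANTS.md`.  Every number below is an exact rational decided by the KERNEL (`decide +kernel`; no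
`native_decide`); no definitions of mathematical content (only Boolean event predicates on the `2⁹` configurations of the listed pairs and a
cheap mass function), no named facts, no sorries.

CONTEXT.  van den Berg–Häggström–Kahn (2006) prove that, conditioned on `{y ↮ X}`, the open cluster `C_y` is positively associated
(Thm. 1.2/1.3), and that, conditioned on `{s ↮ t}`, increasing functions of `C_s` and decreasing functions of `C_t` are positively associated
(Thm. 1.5 / 2.1).  The cylinder programme for the conjecture `Consts.MDLXJoint` (memo `FROM-prim-consts-2-g10-VERTEX-INDUCTION.md` §3) splits
the two-source kernel inequality R(S) as `K(s,X)·R1 + R2` and reduces R1 to the following natural strengthening, conjectured there on the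
evidence of 302/302 + 1 700/1 700 + 7 550/7 550 exact instances (`n ≤ 7`, corner weights):

  (3SEP-PA)  conditioned on THREE-WAY SEPARATION `T = {y ↮ s} ∩ {y ↮ X} ∩ {s ↮ X}` (`= 𝒜 ∩ D` in the notation of `Consts.MDLXJoint`),
             the cluster `C_y` is positively associated; in particular `P(y ↔ u, y ↔ z | T) ≥ P(y ↔ u | T)·P(y ↔ z | T)`.

**(3SEP-PA) IS FALSE**, already for two connection events.  PRIOR EVIDENCE (found after this file was written, recorded for attribution):
the same statement for three single VERTICES — cell "K3-A", conditional positive association of `C_s` given the clique separation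
`{s ↮ t} ∩ {s ↮ u} ∩ {t ↮ u}` — was refuted at census level by ttrl2 for prim-hp-7 on 2026-08-19 (`run/shared/lean/ttrl/k3cells/README.md`:
clean `n = 6` witness with all weights `1/2` but two of weight `1 − ε`, even a `p = 1/2` multigraph in count form; mechanism "hub dichotomy /
collider selection"), as noted in the docstring of `Literature/Probability/Percolation/ThreeWaySeparationRows.lean`, whose
`threeSep_increasing_exchange` is the printed-strength shadow (the guard `{t ↮ u}` in three of the four factors).  This file is the first KERNEL
certificate (an independent `n = 7` witness) and draws the consequence for R(S).  WITNESS (this file): `n = 7`, listed pairs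
`(0,1),(0,2),(1,3),(2,4),(3,6),(4,6)` with weight `15/16` and `(5,6),(1,5),(2,6)` with weight `3/4` (every other pair `0`);
`y = 0, u = 1, z = 2, s = 3, X = {4}`.  Exactly:
`μ(T) = 495199/2³⁰`, `μ(T ∩ {y↔u}) = 202065/2³⁰`, `μ(T ∩ {y↔z}) = 156165/2³⁰`, `μ(T ∩ {y↔u} ∩ {y↔z}) = 15615/2²⁸`, so
`μ(T ∩ {y↔u} ∩ {y↔z})·μ(T) − μ(T ∩ {y↔u})·μ(T ∩ {y↔z}) = −625351185/2⁶⁰ < 0`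
(conditionally: `P(y↔u, y↔z | T) = 0.1261 < 0.4080 · 0.3154 = 0.1287`).  MECHANISM ("frustration"): `y` repels `s`, `s` repels `X`,
`X` repels `y`; growing `C_y` towards `u` (next to `s`) shrinks `C_s`, which frees `C_X = C_4` around the hub `6`, which blocks `y ↔ z`
(`z = 2` hangs off `4` and `6`) — an odd cycle of repulsions, absent from the two-party settings of BHK's theorems.  On the 11-pair
supergraph `+ (3,5),(4,5)` the violation holds at ALL EQUAL weights `p ≥ 7/8` and tends to `P(y↔u,y↔z | T) → 0` as `p → 1`.
CONSEQUENCES recorded here: (i) `threeSep_connections_negCorrelated` — the display above; (ii) `threeSep_R1_neg` — the inequality R1 of the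
memo's split (`μ(T)·a(z) ≥ μ(T ∩ {y↔z})·a(y)`, `a(t) = μ(s ↮ X, u ↮ X, u ↔ t, s ↮ t)`) FAILS at the same witness
(`μ(T)·a(z) − μ(T∩{y↔z})·a(y) = −152995203/2⁵⁸`); (iii) `not_threeSep_posCorrelation` — the universally quantified statement, in the binder
style of `Consts.MDLXJoint`, is false.  What the witness does NOT touch: `Consts.MDLXJoint` itself — at the witness the pair form of R(S)
(`= μ(s↮X)·R1 + R2`) is `+0.046` in units of `μ(T)μ(s↮X)²`, R2 compensating R1 — nor BHK's theorems, nor any landed kernel file; it closes the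
route "R1 ⟸ positive association under three-way separation" of memo g10 §3/§6(i) and corrects gen 9/10's census lines (302/302, 1 700/1 700;
too coarse — the violations need dense weights, cf. the k3cells threshold `ε* ≈ 1/92`).
METHOD: the kernel-arithmetic bridge `FK.RCEval` (`…LowerTailFKExactEval.lean`) at cluster weight `q = 1` (`rcMeasureW w 1 ∅ = prodBernoulli w`)
turns each measure into a `512`-term sum of products of nine rationals over the configurations of the listed pairs, the events being read by
the computable open-walk reachability `FK.RCEval.reachB` (`reachB_iff`).
[cite: VandenbergHaggstromKahn2005, Thm. 1.2–1.3 (pp. 5–6), Thm. 1.5 (p. 7), Thm. 2.1 (p. 9)] [cite: Grimmett2006, §1.4 eq. (1.20) (p. 15)]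
-/

namespace Summit.CriticalPhenomena.PercolationContinuityZ3.Theorems

namespace Consts

open MeasureTheory Literature.Probability.LatticeModels Literature.Probability.Percolation

namespace ThreeSepCex

/-- The witness as listed data: seven vertices `y = 0, u = 1, z = 2, s = 3, x = 4, c = 5, d = 6`, nine pairs
`yu, yz, us, zx, sd, xd` (weight `15/16`) and `cd, uc, zd` (weight `3/4`), cluster weight `q = 1`. (this seat, gen 11) -/
abbrev G : FK.RCEval := ⟨7, 9, ![0, 0, 1, 2, 3, 4, 5, 1, 2], ![1, 2, 3, 4, 6, 6, 6, 5, 6],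
  ![15 / 16, 15 / 16, 15 / 16, 15 / 16, 15 / 16, 15 / 16, 3 / 4, 3 / 4, 3 / 4], 1⟩

/-- The listing is valid. [folklore] -/
theorem G_valid : G.Valid := by decide +kernel

/-! ### Cheap masses (`q = 1`: no cluster count) and the event predicates by open walks -/

/-- `Σ_t [P t] · ∏_i (c_i or 1 − c_i)` — the mass of a predicate under the product weights (computable, no cluster count). [folklore] -/
def massW (P : Finset (Fin 9) → Bool) : ℚ := ∑ t : Finset (Fin 9), if P t then G.wQ t else 0

/-- At `q = 1`, `massQ = massW`. [folklore] -/
theorem massQ_eq_massW (P : Finset (Fin 9) → Bool) : G.massQ P = massW P := by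
  unfold FK.RCEval.massQ massW FK.RCEval.mQ
  refine Finset.sum_congr rfl fun t _ => ?_
  have hq : G.q = 1 := rfl
  rw [hq, one_pow, mul_one]

/-- At `q = 1`, `ZQ = Σ_t wQ t`. [folklore] -/
theorem zq_eq : G.ZQ = massW (fun _ => true) := by
  unfold FK.RCEval.ZQ massW FK.RCEval.mQ
  refine Finset.sum_congr rfl fun t _ => ?_
  have hq : G.q = 1 := rfl
  rw [hq, one_pow, mul_one, if_pos rfl]

/-- `T = {y ↮ s} ∩ {y ↮ x} ∩ {s ↮ x}` (three-way separation), by open walks. -/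
def pT (t : Finset (Fin 9)) : Bool := !G.reachB t 0 3 && !G.reachB t 0 4 && !G.reachB t 3 4
/-- `T ∩ {y ↔ u}`. -/
def pTA (t : Finset (Fin 9)) : Bool := pT t && G.reachB t 0 1
/-- `T ∩ {y ↔ z}`. -/
def pTB (t : Finset (Fin 9)) : Bool := pT t && G.reachB t 0 2
/-- `T ∩ {y ↔ u} ∩ {y ↔ z}`. -/
def pTAB (t : Finset (Fin 9)) : Bool := pT t && G.reachB t 0 1 && G.reachB t 0 2
/-- The event of `a(z)`: `{s ↮ x} ∩ {u ↮ x} ∩ {u ↔ z} ∩ {s ↮ z}`. -/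
def pAz (t : Finset (Fin 9)) : Bool := !G.reachB t 3 4 && !G.reachB t 1 4 && G.reachB t 1 2 && !G.reachB t 3 2

/-! ### Kernel arithmetic (`decide +kernel`, `2⁹` configurations each: open walks and products of nine rationals) -/

set_option maxHeartbeats 0 in
/-- `Z = 1`. [folklore] -/
theorem massW_true : massW (fun _ => true) = 1 := by decide +kernel
set_option maxHeartbeats 0 in
/-- mass of `T`. (this seat, gen 11; two independent exact engines agree) -/
theorem mass_T : massW pT = 495199 / 1073741824 := by decide +kernel
set_option maxHeartbeats 0 in
/-- mass of `T ∩ {y ↔ u}`. -/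
theorem mass_TA : massW pTA = 202065 / 1073741824 := by decide +kernel
set_option maxHeartbeats 0 in
/-- mass of `T ∩ {y ↔ z}`. -/
theorem mass_TB : massW pTB = 156165 / 1073741824 := by decide +kernel
set_option maxHeartbeats 0 in
/-- mass of `T ∩ {y ↔ u} ∩ {y ↔ z}`. -/
theorem mass_TAB : massW pTAB = 15615 / 268435456 := by decide +kernel
set_option maxHeartbeats 0 in
/-- mass of the `a(z)`-event. -/
theorem mass_Az : massW pAz = 62487 / 1073741824 := by decide +kernel

/-! ### From open walks to the events of the statements -/

/-- Reachability in the listed configuration as a Boolean. [folklore] -/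
theorem reach_iff (t : Finset (Fin 9)) (a b : Fin 7) :
    (openGraph (V := Fin 7) (G.conf t)).Reachable a b ↔ G.reachB t a b = true :=
  (FK.RCEval.reachB_iff (D := G) t a b).symm

/-- The three-way separation event `T = 𝒜 ∩ D` of `Consts.MDLXJoint` at `s = 3, y = 0, X = {4}`. -/
theorem mem_T (t : Finset (Fin 9)) :
    G.conf t ∈ ({ω : BondConfig (Fin 7) | ∀ x ∈ insert (3 : Fin 7) ({4} : Set (Fin 7)), ¬ (openGraph ω).Reachable 0 x} ∩
        {ω | ∀ x ∈ ({4} : Set (Fin 7)), ¬ (openGraph ω).Reachable 3 x}) ↔ pT t = true := by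
  have h03 := reach_iff t 0 3; have h04 := reach_iff t 0 4; have h34 := reach_iff t 3 4
  unfold pT
  generalize G.reachB t 0 3 = a at h03 ⊢; generalize G.reachB t 0 4 = b at h04 ⊢; generalize G.reachB t 3 4 = c at h34 ⊢
  simp only [Set.mem_inter_iff, Set.mem_setOf_eq, Set.mem_insert_iff, Set.mem_singleton_iff, forall_eq_or_imp, forall_eq,
    h03, h04, h34]
  cases a <;> cases b <;> cases c <;> simp

/-- Membership in `T ∩ {y ↔ u}`. -/
theorem mem_TA (t : Finset (Fin 9)) :
    G.conf t ∈ ({ω : BondConfig (Fin 7) | ∀ x ∈ insert (3 : Fin 7) ({4} : Set (Fin 7)), ¬ (openGraph ω).Reachable 0 x} ∩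
        {ω | ∀ x ∈ ({4} : Set (Fin 7)), ¬ (openGraph ω).Reachable 3 x} ∩ openConn 0 1) ↔ pTA t = true := by
  have h03 := reach_iff t 0 3; have h04 := reach_iff t 0 4; have h34 := reach_iff t 3 4; have h01 := reach_iff t 0 1
  unfold pTA pT
  generalize G.reachB t 0 3 = a at h03 ⊢; generalize G.reachB t 0 4 = b at h04 ⊢; generalize G.reachB t 3 4 = c at h34 ⊢
  generalize G.reachB t 0 1 = d at h01 ⊢
  simp only [Set.mem_inter_iff, Set.mem_setOf_eq, Set.mem_insert_iff, Set.mem_singleton_iff, forall_eq_or_imp, forall_eq,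
    openConn, h03, h04, h34, h01]
  cases a <;> cases b <;> cases c <;> cases d <;> simp

/-- Membership in `T ∩ {y ↔ z}`. -/
theorem mem_TB (t : Finset (Fin 9)) :
    G.conf t ∈ ({ω : BondConfig (Fin 7) | ∀ x ∈ insert (3 : Fin 7) ({4} : Set (Fin 7)), ¬ (openGraph ω).Reachable 0 x} ∩
        {ω | ∀ x ∈ ({4} : Set (Fin 7)), ¬ (openGraph ω).Reachable 3 x} ∩ openConn 0 2) ↔ pTB t = true := by
  have h03 := reach_iff t 0 3; have h04 := reach_iff t 0 4; have h34 := reach_iff t 3 4; have h02 := reach_iff t 0 2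
  unfold pTB pT
  generalize G.reachB t 0 3 = a at h03 ⊢; generalize G.reachB t 0 4 = b at h04 ⊢; generalize G.reachB t 3 4 = c at h34 ⊢
  generalize G.reachB t 0 2 = d at h02 ⊢
  simp only [Set.mem_inter_iff, Set.mem_setOf_eq, Set.mem_insert_iff, Set.mem_singleton_iff, forall_eq_or_imp, forall_eq,
    openConn, h03, h04, h34, h02]
  cases a <;> cases b <;> cases c <;> cases d <;> simp

/-- Membership in `T ∩ {y ↔ u} ∩ {y ↔ z}`. -/
theorem mem_TAB (t : Finset (Fin 9)) :
    G.conf t ∈ ({ω : BondConfig (Fin 7) | ∀ x ∈ insert (3 : Fin 7) ({4} : Set (Fin 7)), ¬ (openGraph ω).Reachable 0 x} ∩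
        {ω | ∀ x ∈ ({4} : Set (Fin 7)), ¬ (openGraph ω).Reachable 3 x} ∩ openConn 0 1 ∩ openConn 0 2) ↔ pTAB t = true := by
  have h03 := reach_iff t 0 3; have h04 := reach_iff t 0 4; have h34 := reach_iff t 3 4; have h01 := reach_iff t 0 1
  have h02 := reach_iff t 0 2
  unfold pTAB pT
  generalize G.reachB t 0 3 = a at h03 ⊢; generalize G.reachB t 0 4 = b at h04 ⊢; generalize G.reachB t 3 4 = c at h34 ⊢
  generalize G.reachB t 0 1 = d at h01 ⊢; generalize G.reachB t 0 2 = e at h02 ⊢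
  simp only [Set.mem_inter_iff, Set.mem_setOf_eq, Set.mem_insert_iff, Set.mem_singleton_iff, forall_eq_or_imp, forall_eq,
    openConn, h03, h04, h34, h01, h02]
  cases a <;> cases b <;> cases c <;> cases d <;> cases e <;> simp

/-- Membership in the `a(z)`-event `{s ↮ X} ∩ {u ↮ X} ∩ {u ↔ z} ∩ {s ↮ z}`. -/
theorem mem_Az (t : Finset (Fin 9)) :
    G.conf t ∈ ({ω : BondConfig (Fin 7) | ∀ x ∈ ({4} : Set (Fin 7)), ¬ (openGraph ω).Reachable 3 x} ∩
        {ω | ∀ x ∈ ({4} : Set (Fin 7)), ¬ (openGraph ω).Reachable 1 x} ∩ openConn 1 2 ∩ {ω | ¬ (openGraph ω).Reachable 3 2}) ↔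
      pAz t = true := by
  have h34 := reach_iff t 3 4; have h14 := reach_iff t 1 4; have h12 := reach_iff t 1 2; have h32 := reach_iff t 3 2
  unfold pAz
  generalize G.reachB t 3 4 = a at h34 ⊢; generalize G.reachB t 1 4 = b at h14 ⊢; generalize G.reachB t 1 2 = c at h12 ⊢
  generalize G.reachB t 3 2 = d at h32 ⊢
  simp only [Set.mem_inter_iff, Set.mem_setOf_eq, Set.mem_singleton_iff, forall_eq, openConn, h34, h14, h12, h32]
  cases a <;> cases b <;> cases c <;> cases d <;> simp

/-! ### The five measures as real numbers -/

/-- At `q = 1` the random-cluster measure of the listing is the Bernoulli product measure. [cite: Grimmett2006, §1.3] -/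
theorem rc_eq : rcMeasureW G.w ((G.q : ℚ) : ℝ) ∅ = prodBernoulli G.w := by
  have : ((G.q : ℚ) : ℝ) = 1 := by norm_num [G]
  rw [this]; exact rcMeasureW_one G.w ∅

/-- `μ(T)` at the witness, exactly. -/
theorem real_T :
    (prodBernoulli G.w).real ({ω : BondConfig (Fin 7) | ∀ x ∈ insert (3 : Fin 7) ({4} : Set (Fin 7)), ¬ (openGraph ω).Reachable 0 x} ∩
        {ω | ∀ x ∈ ({4} : Set (Fin 7)), ¬ (openGraph ω).Reachable 3 x}) = ((495199 / 1073741824 : ℚ) : ℝ) := by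
  have h := FK.RCEval.real_eq_massQ_div G_valid (mem_T)
  rw [rc_eq, massQ_eq_massW, mass_T, zq_eq, massW_true, div_one] at h
  exact h

/-- `μ(T ∩ {y ↔ u})` at the witness, exactly. -/
theorem real_TA :
    (prodBernoulli G.w).real ({ω : BondConfig (Fin 7) | ∀ x ∈ insert (3 : Fin 7) ({4} : Set (Fin 7)), ¬ (openGraph ω).Reachable 0 x} ∩
        {ω | ∀ x ∈ ({4} : Set (Fin 7)), ¬ (openGraph ω).Reachable 3 x} ∩ openConn 0 1) = ((202065 / 1073741824 : ℚ) : ℝ) := by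
  have h := FK.RCEval.real_eq_massQ_div G_valid (mem_TA)
  rw [rc_eq, massQ_eq_massW, mass_TA, zq_eq, massW_true, div_one] at h
  exact h

/-- `μ(T ∩ {y ↔ z})` at the witness, exactly. -/
theorem real_TB :
    (prodBernoulli G.w).real ({ω : BondConfig (Fin 7) | ∀ x ∈ insert (3 : Fin 7) ({4} : Set (Fin 7)), ¬ (openGraph ω).Reachable 0 x} ∩
        {ω | ∀ x ∈ ({4} : Set (Fin 7)), ¬ (openGraph ω).Reachable 3 x} ∩ openConn 0 2) = ((156165 / 1073741824 : ℚ) : ℝ) := by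
  have h := FK.RCEval.real_eq_massQ_div G_valid (mem_TB)
  rw [rc_eq, massQ_eq_massW, mass_TB, zq_eq, massW_true, div_one] at h
  exact h

/-- `μ(T ∩ {y ↔ u} ∩ {y ↔ z})` at the witness, exactly. -/
theorem real_TAB :
    (prodBernoulli G.w).real ({ω : BondConfig (Fin 7) | ∀ x ∈ insert (3 : Fin 7) ({4} : Set (Fin 7)), ¬ (openGraph ω).Reachable 0 x} ∩
        {ω | ∀ x ∈ ({4} : Set (Fin 7)), ¬ (openGraph ω).Reachable 3 x} ∩ openConn 0 1 ∩ openConn 0 2) =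
      ((15615 / 268435456 : ℚ) : ℝ) := by
  have h := FK.RCEval.real_eq_massQ_div G_valid (mem_TAB)
  rw [rc_eq, massQ_eq_massW, mass_TAB, zq_eq, massW_true, div_one] at h
  exact h

/-- `a(z) = μ(s ↮ X, u ↮ X, u ↔ z, s ↮ z)` at the witness, exactly. -/
theorem real_Az :
    (prodBernoulli G.w).real ({ω : BondConfig (Fin 7) | ∀ x ∈ ({4} : Set (Fin 7)), ¬ (openGraph ω).Reachable 3 x} ∩
        {ω | ∀ x ∈ ({4} : Set (Fin 7)), ¬ (openGraph ω).Reachable 1 x} ∩ openConn 1 2 ∩ {ω | ¬ (openGraph ω).Reachable 3 2}) =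
      ((62487 / 1073741824 : ℚ) : ℝ) := by
  have h := FK.RCEval.real_eq_massQ_div G_valid (mem_Az)
  rw [rc_eq, massQ_eq_massW, mass_Az, zq_eq, massW_true, div_one] at h
  exact h

/-! ### The refutations -/

/-- **Two connection events of `C_y` are strictly NEGATIVELY correlated given three-way separation** (`y = 0, u = 1, z = 2, s = 3,
X = {4}`): `μ(T ∩ {y↔u} ∩ {y↔z})·μ(T) < μ(T ∩ {y↔u})·μ(T ∩ {y↔z})` with `T = {y ↮ {s}∪X} ∩ {s ↮ X}`; the margin is
`−625351185/2⁶⁰`.  So the three-way-separated law of `C_y` is not positively associated.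
[cite: VandenbergHaggstromKahn2005, Thm. 1.2–1.3 (pp. 5–6)] -/
theorem threeSep_connections_negCorrelated :
    (prodBernoulli G.w).real ({ω : BondConfig (Fin 7) | ∀ x ∈ insert (3 : Fin 7) ({4} : Set (Fin 7)), ¬ (openGraph ω).Reachable 0 x} ∩
          {ω | ∀ x ∈ ({4} : Set (Fin 7)), ¬ (openGraph ω).Reachable 3 x} ∩ openConn 0 1 ∩ openConn 0 2) *
        (prodBernoulli G.w).real ({ω : BondConfig (Fin 7) | ∀ x ∈ insert (3 : Fin 7) ({4} : Set (Fin 7)), ¬ (openGraph ω).Reachable 0 x} ∩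
          {ω | ∀ x ∈ ({4} : Set (Fin 7)), ¬ (openGraph ω).Reachable 3 x}) <
      (prodBernoulli G.w).real ({ω : BondConfig (Fin 7) | ∀ x ∈ insert (3 : Fin 7) ({4} : Set (Fin 7)), ¬ (openGraph ω).Reachable 0 x} ∩
          {ω | ∀ x ∈ ({4} : Set (Fin 7)), ¬ (openGraph ω).Reachable 3 x} ∩ openConn 0 1) *
        (prodBernoulli G.w).real ({ω : BondConfig (Fin 7) | ∀ x ∈ insert (3 : Fin 7) ({4} : Set (Fin 7)), ¬ (openGraph ω).Reachable 0 x} ∩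
          {ω | ∀ x ∈ ({4} : Set (Fin 7)), ¬ (openGraph ω).Reachable 3 x} ∩ openConn 0 2) := by
  rw [real_TAB, real_T, real_TA, real_TB]
  norm_num

/-- **The inequality R1 of the cylinder split FAILS** (memo g10 §3: `μ(T)·a(z) ≥ μ(T ∩ {y↔z})·a(y)` with
`a(t) = μ(s ↮ X, u ↮ X, u ↔ t, s ↮ t)`; here `a(y) = μ(T ∩ {y↔u})` since `{y↔u} ∩ T ⊆ {u ↮ X}`): at the witness
`μ(T)·a(z) − μ(T ∩ {y↔z})·μ(T ∩ {y↔u}) = −152995203/2⁵⁸ < 0`.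
[cite: VandenbergHaggstromKahn2005, Thm. 2.1 (p. 9)] -/
theorem threeSep_R1_neg :
    (prodBernoulli G.w).real ({ω : BondConfig (Fin 7) | ∀ x ∈ insert (3 : Fin 7) ({4} : Set (Fin 7)), ¬ (openGraph ω).Reachable 0 x} ∩
          {ω | ∀ x ∈ ({4} : Set (Fin 7)), ¬ (openGraph ω).Reachable 3 x}) *
        (prodBernoulli G.w).real ({ω : BondConfig (Fin 7) | ∀ x ∈ ({4} : Set (Fin 7)), ¬ (openGraph ω).Reachable 3 x} ∩
          {ω | ∀ x ∈ ({4} : Set (Fin 7)), ¬ (openGraph ω).Reachable 1 x} ∩ openConn 1 2 ∩ {ω | ¬ (openGraph ω).Reachable 3 2}) <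
      (prodBernoulli G.w).real ({ω : BondConfig (Fin 7) | ∀ x ∈ insert (3 : Fin 7) ({4} : Set (Fin 7)), ¬ (openGraph ω).Reachable 0 x} ∩
          {ω | ∀ x ∈ ({4} : Set (Fin 7)), ¬ (openGraph ω).Reachable 3 x} ∩ openConn 0 2) *
        (prodBernoulli G.w).real ({ω : BondConfig (Fin 7) | ∀ x ∈ insert (3 : Fin 7) ({4} : Set (Fin 7)), ¬ (openGraph ω).Reachable 0 x} ∩
          {ω | ∀ x ∈ ({4} : Set (Fin 7)), ¬ (openGraph ω).Reachable 3 x} ∩ openConn 0 1) := by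
  rw [real_T, real_Az, real_TB, real_TA]
  norm_num

end ThreeSepCex

/-- **THEOREM: positive correlation of connection events under three-way separation is NOT a law of percolation.**  It is false that
for every finite weighted graph, owner `s`, avoided set `X`, vertex `y` and targets `u, z`, the events `{y ↔ u}`, `{y ↔ z}` are
positively correlated given `{y ↮ {s}∪X} ∩ {s ↮ X}` (the conditioning event `𝒜 ∩ D` of `Consts.MDLXJoint`); witness
`Consts.ThreeSepCex.threeSep_connections_negCorrelated`.  Contrast: given `{y ↮ {s}∪X}` alone they ARE positively correlated
(van den Berg–Kahn 2001; BHK Thm. 1.3 with sets, `BHK2006_setClusterConditionalPositiveAssociation`).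
[cite: VandenbergHaggstromKahn2005, Thm. 1.2–1.3 (pp. 5–6) with Remark 1 (p. 5)] -/
theorem not_threeSep_posCorrelation : ¬ (∀ (n : ℕ) (w : Sym2 (Fin n) → unitInterval) (s y z u : Fin n) (X : Set (Fin n)),
    (prodBernoulli w).real ({ω : BondConfig (Fin n) | ∀ x ∈ insert s X, ¬ (openGraph ω).Reachable y x} ∩
          {ω | ∀ x ∈ X, ¬ (openGraph ω).Reachable s x} ∩ openConn y u) *
        (prodBernoulli w).real ({ω : BondConfig (Fin n) | ∀ x ∈ insert s X, ¬ (openGraph ω).Reachable y x} ∩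
          {ω | ∀ x ∈ X, ¬ (openGraph ω).Reachable s x} ∩ openConn y z) ≤
      (prodBernoulli w).real ({ω : BondConfig (Fin n) | ∀ x ∈ insert s X, ¬ (openGraph ω).Reachable y x} ∩
          {ω | ∀ x ∈ X, ¬ (openGraph ω).Reachable s x} ∩ openConn y u ∩ openConn y z) *
        (prodBernoulli w).real ({ω : BondConfig (Fin n) | ∀ x ∈ insert s X, ¬ (openGraph ω).Reachable y x} ∩
          {ω | ∀ x ∈ X, ¬ (openGraph ω).Reachable s x})) := by
  intro h
  have h7 := h 7 ThreeSepCex.G.w 3 0 2 1 ({4} : Set (Fin 7))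
  exact absurd h7 (not_le.2 ThreeSepCex.threeSep_connections_negCorrelated)

/-- **The same for the OWNER's cluster** (the form used in memo g9 §8 "C_s PA under three-way separation, 302/302" and in referee g64 item (3)): it is
false that for every finite weighted graph, `s, y`, avoided set `X` and targets `a, b`, the events `{s ↔ a}`, `{s ↔ b}` are positively correlated given
`{y ↮ {s}∪X} ∩ {s ↮ X}`.  For `|X| = 1` the conditioning event is symmetric in the three singletons, so this is `not_threeSep_posCorrelation` with the
roles of `s` and `y` exchanged (same witness, `s = 0`, `y = 3`, `a = 1`, `b = 2`, `X = {4}`).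
[cite: VandenbergHaggstromKahn2005, Thm. 1.2–1.3 (pp. 5–6) with Remark 1 (p. 5)] -/
theorem not_threeSep_posCorrelation_owner : ¬ (∀ (n : ℕ) (w : Sym2 (Fin n) → unitInterval) (s y a b : Fin n) (X : Set (Fin n)),
    (prodBernoulli w).real ({ω : BondConfig (Fin n) | ∀ x ∈ insert s X, ¬ (openGraph ω).Reachable y x} ∩
          {ω | ∀ x ∈ X, ¬ (openGraph ω).Reachable s x} ∩ openConn s a) *
        (prodBernoulli w).real ({ω : BondConfig (Fin n) | ∀ x ∈ insert s X, ¬ (openGraph ω).Reachable y x} ∩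
          {ω | ∀ x ∈ X, ¬ (openGraph ω).Reachable s x} ∩ openConn s b) ≤
      (prodBernoulli w).real ({ω : BondConfig (Fin n) | ∀ x ∈ insert s X, ¬ (openGraph ω).Reachable y x} ∩
          {ω | ∀ x ∈ X, ¬ (openGraph ω).Reachable s x} ∩ openConn s a ∩ openConn s b) *
        (prodBernoulli w).real ({ω : BondConfig (Fin n) | ∀ x ∈ insert s X, ¬ (openGraph ω).Reachable y x} ∩
          {ω | ∀ x ∈ X, ¬ (openGraph ω).Reachable s x})) := by
  intro h
  have h7 := h 7 ThreeSepCex.G.w 0 3 1 2 ({4} : Set (Fin 7))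
  -- the conditioning event with the roles of `s = 0` and `y = 3` exchanged is the same set
  have hT : ({ω : BondConfig (Fin 7) | ∀ x ∈ insert (0 : Fin 7) ({4} : Set (Fin 7)), ¬ (openGraph ω).Reachable 3 x} ∩
        {ω | ∀ x ∈ ({4} : Set (Fin 7)), ¬ (openGraph ω).Reachable 0 x}) =
      ({ω : BondConfig (Fin 7) | ∀ x ∈ insert (3 : Fin 7) ({4} : Set (Fin 7)), ¬ (openGraph ω).Reachable 0 x} ∩
        {ω | ∀ x ∈ ({4} : Set (Fin 7)), ¬ (openGraph ω).Reachable 3 x}) := by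
    ext ω
    simp only [Set.mem_inter_iff, Set.mem_setOf_eq, Set.mem_insert_iff, Set.mem_singleton_iff, forall_eq_or_imp, forall_eq]
    exact ⟨fun ⟨⟨h30, h34⟩, h04⟩ => ⟨⟨fun h03 => h30 h03.symm, h04⟩, h34⟩,
      fun ⟨⟨h03, h04⟩, h34⟩ => ⟨⟨fun h30 => h03 h30.symm, h34⟩, h04⟩⟩
  rw [hT] at h7
  exact absurd h7 (not_le.2 ThreeSepCex.threeSep_connections_negCorrelated)

end Consts

end Summit.CriticalPhenomena.PercolationContinuityZ3.Theorems
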